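import Summits.QuantumFields.YangMills.Theorems.UV3AxialLaunderingFreeSlot
import Literature.MathematicalPhysics.QuantumFieldTheory.Balaban1983to89.BlockAveragingHaarAC
import HarnessLib

/-!
# R3 (cell `ym3-torus`, YM₃ on T³ — a ladder RUNG, NOT d = 4, NOT infinite volume, NOT a mass gap, NOT the Clay problem) —
# **(F-M1) THE DISTORTED-SET RECURSION OF THE hTop BRANCH EXPANSION: ghosts sit on towers, exit chains are private down to the bottom level,
# and the GHOST CENSUS `(L − 1)·#ghosts ≤ (1 + r₁)·#fired` (lattice bookkeeping, def-free, abstract over the read sets)**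

Width seat `ym3-torus-px8` g13 on crux `stmt-QuantumFields-19936` `UnitScaleTilt.HistoryTailL` (`--supports`, helper; THEOREMS ONLY, 0 `def`, 0 `sorry`,
default heartbeats).  Item (F-M1) of LEAD ★w1-19936 g12's design note `Cruxes/HistoryTailL/HTopBranchExpansion.md` §4 (M) ∕ §6, plus the lattice half of
px13 g13's FINDING #51 (★★OWNER g34 WORD 89 (5)) «shared readers ⇒ ghost census».  RECORD CURRENCY: record-independent kinematics of the guarded averaging
`avT3` — supply for hTop (read by no row of the χ record `AlphaInputsT3ACv4RecChi`); nothing of hTop, of the record, of `HistoryTailL` or of rung R3 is proved here.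

THE LETTERS (§4 of the note, ABSOLUTE levels `k ≥ j`, everything a HYPOTHESIS-SPECIFIED family — no definition is made):
* fired slices `s k ⊆ PBond P (k+1)` (the sites of the constrained set `𝐬` at level `k`), read sets `R k c ⊆ PBond P k` of the guard ∕ EML map of `c ∈ PBond P (k+1)`
  (abstract; for the (0.4) guard: the `loopWord` walk bonds, ✓`BalabanUVNodesN08GuardReadSet`), `Read k = ⋃_{c ∈ s k} R k c` (hypothesis `hRead`, membership form);
* the DISTORTED sets `Dist k ⊆ PBond P k`: `Dist j = ∅` (`hDj`) and, for `j ≤ k`, `C ∈ Dist (k+1) ↔ C ∈ s k ∨ ∀ t < L, line C t ∈ Dist k ∪ Read k` (`hDsucc`) — «no private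
  Haar slot below»; a GHOST at level `k+1` is a bond of `Dist (k+1) ∖ s k`.
The two properties of the read sets that are ever used enter AS HYPOTHESES and are discharged elsewhere for the concrete guard:
(PRIV) `c′ ≠ c ⇒ centralBond c′ ∉ R k c` — the crossing bond of a segment is read by its own guard only (lit ✓`BlockAveragingHaarAC.eq_of_mem_walk_loopWord_of_eq_centralBond`;
§2 gives the one-line discharge in membership form); (SIDE) `#{b ∈ R k c | b on the segment of some C ≠ c} ≤ r₁`, stated in TEST-SET form `∀ T ⊆ R k c, (∀ b ∈ T, ∃ C ≠ c, ∃ t < L, b = line C t) → #T ≤ r₁` (no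
decidability in the statement) — a guard reads at most `r₁` bonds of OTHER segments (the inner halves of the `4d − 2` star segments: `r₁ = (2d − 1)(L − 1)`, `= 10` at
`d = L = 3`; dag-n08-d g47 `N08-HJ-M3-SPEC-g47.md` §1 = w2 g17's CAPACITY `s₀`; its Finset discharge = (M3b), not here).

CONTENTS.
* §1 segments: `eq_of_line_eq` (a fine bond lies on at most ONE segment — tower uniqueness; px8 ✓`UV3AxialLaunderingFreeSlot.line_inj`), ★ `card_image_line_product`
  (`(C, t) ↦ line C t` is injective on `A × range L`: `#image = L·#A`).
* §2 the recursion: `mem_dist_succ_of_mem_fired`, `line_mem_of_ghost`, `not_mem_read_of_forall_ne`, ★ `centralBond_mem_dist_of_ghost` (remark (c) of the note: «ghosts sit exactly on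
  towers» — a ghost's crossing bond is distorted one level down), `mem_fired_of_mem_dist_succ_bot` (no ghosts at the first level), and the (PRIV) discharge
  `centralBond_not_read_by_loopWord`.
* §3 ★★ `exists_exit_chain` — THE EXIT CHAIN OF (M)'S PROOF: if `b ∉ Dist (n+1)` (`j ≤ n`) there is a chain `c (n+1) = b`, `c k = line (c (k+1)) t_k` (`j ≤ k ≤ n`) with every
  `c k ∉ Dist k`, `c k ∉ Read k` and `c (k+1) ∉ s k` — the private Haar slot `U(c j)` at the bottom on which the one-slot Fubini of ✓`UV3BranchExpansionKernels` §2 acts.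
* §4 ★★ THE GHOST CENSUS: one level `L·#ghosts_{k+1} ≤ #Dist k + #(Read k ∩ segments of ghosts)` (`line_mul_card_ghosts_le`), the reader term `≤ r₁·#s k` under (SIDE)
  (`card_read_on_ghost_lines_le`), the abstract telescoping `census_of_rows`, and the model statement ★★ `ghost_census`:
  **`L·G N + #Dist N ≤ G N + (1 + r₁)·F N`**, `G N := Σ_{k ∈ [j,N)} #(Dist (k+1) ∖ s k)`, `F N := Σ_{k ∈ [j,N)} #s k` — i.e. `#ghosts(𝐬) ≤ (1 + r₁)∕(L − 1)·|𝐬|` for EVERY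
  constrained set, `K`- and `j`-free (FINDING #51 (2)).

HONEST SCOPE.  [folklore] finite lattice bookkeeping on lit `AveragingRT` objects; 0 `def`, 0 `instance`, standard axioms.  NOT here: the functional-dependence lemma of (M)
((F-M2)), the injection live ↦ exploration tree ((F-C1), frozen by ★★OWNER WORD 89 (5a) until the LEAD rules on FINDING #51), any numeral, (SIDE)'s discharge.  Nothing of hTop ∕
the χ record's rows ∕ (O‴χₛ) ∕ `HistoryTailL` (19936) ∕ the rung `YM3TorusSU2` is proved; rung R3 = SU(2) YM₃ on T³ — NOT d = 4, NOT infinite volume, NOT a mass gap, NOT Clay;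
the Yang–Mills mass gap is NOT proved.

References: T. Bałaban, Commun. Math. Phys. **109** (1987) 249–301 [Balaban1987RG1] ((0.1)–(0.4) pp. 251–253: blocks, straight contours, the small-field guard);
T. Bałaban, Commun. Math. Phys. **95** (1984) 17–40 [Balaban1984PropagatorsI] ((1.7) p. 18, the straight contour `Γ_{y,x}`); LEAD note `Cruxes/HistoryTailL/HTopBranchExpansion.md`
§4 (M) remark (c), §5, §6 (F-M1); px13 g13 FINDING #51 (ym3-torus STATUS 2026-08-30T03:29:20Z).
-/

set_option autoImplicit false

open Finset Function

namespace Summit.QuantumFields.YangMills.Theorems.UV3BranchExpansionDistortedSet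

open Literature.MathematicalPhysics.QuantumFieldTheory.Balaban1983to89
open Literature.MathematicalPhysics.QuantumFieldTheory.Balaban1983to89.AveragingRT
open Literature.MathematicalPhysics.QuantumFieldTheory.Balaban1983to89.T4Continuum (walk loopWord)
open Literature.MathematicalPhysics.QuantumFieldTheory.Balaban1983to89.BlockAveraging (Idx off)
open Literature.MathematicalPhysics.QuantumFieldTheory.Balaban1983to89.BlockAveragingHaarAC (centralBond
  eq_of_mem_walk_loopWord_of_eq_centralBond)
open Summit.QuantumFields.YangMills.Theorems.UV3AxialLaunderingFreeSlot (line_inj)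

variable {P : Params}

/-! ## §1 Segments: a fine bond lies on at most one segment; `(C, t) ↦ line C t` is injective -/
section Segments

variable {k : ℕ}

/-- **TOWER UNIQUENESS**: a fine bond lies on at most one straight segment — `line C t = line C′ t′` (`t, t′ < L`) forces `C = C′` (standing range).
[cite: Balaban1984PropagatorsI, (1.7) p.18] -/
theorem eq_of_line_eq (hk : k + 1 ≤ P.m + P.K) {C C' : PBond P (k + 1)} {t t' : ℕ} (ht : t < P.L) (ht' : t' < P.L)
    (h : line C t = line C' t') : C = C' :=
  (line_inj hk ht ht' h).1

/-- … and the position on the segment is determined too. [cite: Balaban1984PropagatorsI, (1.7) p.18] -/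
theorem eq_of_line_eq' (hk : k + 1 ≤ P.m + P.K) {C C' : PBond P (k + 1)} {t t' : ℕ} (ht : t < P.L) (ht' : t' < P.L)
    (h : line C t = line C' t') : t = t' :=
  (line_inj hk ht ht' h).2

/-- The crossing bond is the middle bond of the segment (`centralBond C = line C ((L−1)∕2)`, lit `BlockAveragingHaarAC`). [cite: Balaban1987RG1, (0.3) p.252] -/
theorem centralBond_eq_line (C : PBond P (k + 1)) : centralBond C = line C ((P.L - 1) / 2) := rfl

/-- ★ **THE SEGMENT MAP IS INJECTIVE ON `A × range L`**: the bonds `line C t`, `C ∈ A`, `t < L`, are pairwise distinct, so their number is `L·#A` (standing range).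
[cite: Balaban1984PropagatorsI, (1.7) p.18] -/
theorem card_image_line_product [DecidableEq (PBond P k)] (hk : k + 1 ≤ P.m + P.K) (A : Finset (PBond P (k + 1))) :
    ((A ×ˢ Finset.range P.L).image (fun p : PBond P (k + 1) × ℕ => line p.1 p.2)).card = P.L * A.card := by
  rw [Finset.card_image_of_injOn, Finset.card_product, Finset.card_range, Nat.mul_comm]
  rintro ⟨C, t⟩ hp ⟨C', t'⟩ hp' h
  simp only [Finset.coe_product, Set.mem_prod, Finset.mem_coe, Finset.mem_range] at hp hp'
  obtain ⟨hC, ht⟩ := line_inj hk hp.2 hp'.2 h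
  exact Prod.ext hC ht

end Segments

/-! ## §2 The distorted-set recursion (as hypotheses): ghosts sit on towers -/
section Recursion

variable {j : ℕ} (s : (k : ℕ) → Finset (PBond P (k + 1))) (R : (k : ℕ) → PBond P (k + 1) → Finset (PBond P k))
  (Read : (k : ℕ) → Finset (PBond P k)) (Dist : (k : ℕ) → Finset (PBond P k))

/-- A FIRED bond is distorted at the next level. [folklore] -/
theorem mem_dist_succ_of_mem_fired
    (hDsucc : ∀ k, j ≤ k → ∀ C : PBond P (k + 1), C ∈ Dist (k + 1) ↔ (C ∈ s k ∨ ∀ t, t < P.L → (line C t ∈ Dist k ∨ line C t ∈ Read k)))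
    {k : ℕ} (hk : j ≤ k) {C : PBond P (k + 1)} (hC : C ∈ s k) : C ∈ Dist (k + 1) :=
  (hDsucc k hk C).2 (Or.inl hC)

/-- A GHOST (distorted, not fired) has every bond of its segment distorted or read one level down. [folklore] -/
theorem line_mem_of_ghost
    (hDsucc : ∀ k, j ≤ k → ∀ C : PBond P (k + 1), C ∈ Dist (k + 1) ↔ (C ∈ s k ∨ ∀ t, t < P.L → (line C t ∈ Dist k ∨ line C t ∈ Read k)))
    {k : ℕ} (hk : j ≤ k) {C : PBond P (k + 1)} (hC : C ∈ Dist (k + 1)) (hCs : C ∉ s k) {t : ℕ} (ht : t < P.L) :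
    line C t ∈ Dist k ∨ line C t ∈ Read k :=
  ((hDsucc k hk C).1 hC).resolve_left hCs t ht

/-- A bond NOT distorted at level `k+1` is not fired and has a segment bond neither distorted nor read. [folklore] -/
theorem exists_line_not_mem_of_not_mem_dist
    (hDsucc : ∀ k, j ≤ k → ∀ C : PBond P (k + 1), C ∈ Dist (k + 1) ↔ (C ∈ s k ∨ ∀ t, t < P.L → (line C t ∈ Dist k ∨ line C t ∈ Read k)))
    {k : ℕ} (hk : j ≤ k) {C : PBond P (k + 1)} (hC : C ∉ Dist (k + 1)) :
    C ∉ s k ∧ ∃ t, t < P.L ∧ line C t ∉ Dist k ∧ line C t ∉ Read k := by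
  have h := mt (hDsucc k hk C).2 hC
  push Not at h
  obtain ⟨hs, t, ht, hD, hR⟩ := h
  exact ⟨hs, t, ht, hD, hR⟩

/-- (PRIV) in use: if no FIRED bond other than `C` reads `centralBond C` and `C` is not fired, then `centralBond C` is unread. [folklore] -/
theorem not_mem_read_of_forall_ne (hRead : ∀ k (b : PBond P k), b ∈ Read k ↔ ∃ c ∈ s k, b ∈ R k c)
    {k : ℕ} {C : PBond P (k + 1)} (hpriv : ∀ c : PBond P (k + 1), C ≠ c → centralBond C ∉ R k c) (hCs : C ∉ s k) :
    centralBond C ∉ Read k := by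
  intro h
  obtain ⟨c, hc, hb⟩ := (hRead k _).1 h
  exact hpriv c (fun hCc => hCs (hCc ▸ hc)) hb

/-- ★ **GHOSTS SIT EXACTLY ON TOWERS** (remark (c) of the note): under (PRIV) «the crossing bond of a segment is read by its own guard only», a GHOST `C ∈ Dist (k+1) ∖ s k`
has its crossing bond DISTORTED one level down, `centralBond C ∈ Dist k` (it is distorted-or-read as a segment bond, and unread since `C` itself is not fired).
[cite: Balaban1987RG1, (0.3)–(0.4) pp.252–253] -/
theorem centralBond_mem_dist_of_ghost (hRead : ∀ k (b : PBond P k), b ∈ Read k ↔ ∃ c ∈ s k, b ∈ R k c)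
    (hDsucc : ∀ k, j ≤ k → ∀ C : PBond P (k + 1), C ∈ Dist (k + 1) ↔ (C ∈ s k ∨ ∀ t, t < P.L → (line C t ∈ Dist k ∨ line C t ∈ Read k)))
    {k : ℕ} (hk : j ≤ k) (hpriv : ∀ c c' : PBond P (k + 1), c' ≠ c → centralBond c' ∉ R k c)
    {C : PBond P (k + 1)} (hC : C ∈ Dist (k + 1)) (hCs : C ∉ s k) : centralBond C ∈ Dist k :=
  (line_mem_of_ghost s Read Dist hDsucc hk hC hCs (half_lt P)).resolve_right
    (not_mem_read_of_forall_ne s R Read hRead (fun c hCc => hpriv c C hCc) hCs)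

/-- **NO GHOSTS AT THE FIRST LEVEL**: under (PRIV), `Dist (j+1) = s j` as far as membership goes (`Dist j = ∅` leaves no tower to sit on). [folklore] -/
theorem mem_fired_of_mem_dist_succ_bot (hRead : ∀ k (b : PBond P k), b ∈ Read k ↔ ∃ c ∈ s k, b ∈ R k c) (hDj : Dist j = ∅)
    (hDsucc : ∀ k, j ≤ k → ∀ C : PBond P (k + 1), C ∈ Dist (k + 1) ↔ (C ∈ s k ∨ ∀ t, t < P.L → (line C t ∈ Dist k ∨ line C t ∈ Read k)))
    (hpriv : ∀ c c' : PBond P (j + 1), c' ≠ c → centralBond c' ∉ R j c)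
    {C : PBond P (j + 1)} (hC : C ∈ Dist (j + 1)) : C ∈ s j := by
  by_contra hCs
  have h := centralBond_mem_dist_of_ghost s R Read Dist hRead hDsucc le_rfl hpriv hC hCs
  rw [hDj] at h
  exact Finset.notMem_empty _ h

/-- Towers go DOWN one crossing bond per level: under (PRIV) a ghost at level `k+2` has a distorted crossing bond at level `k+1`, which is fired or again a ghost,
whose crossing bond is distorted at level `k`. [folklore] -/
theorem centralBond_centralBond_mem_dist_of_ghost (hRead : ∀ k (b : PBond P k), b ∈ Read k ↔ ∃ c ∈ s k, b ∈ R k c)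
    (hDsucc : ∀ k, j ≤ k → ∀ C : PBond P (k + 1), C ∈ Dist (k + 1) ↔ (C ∈ s k ∨ ∀ t, t < P.L → (line C t ∈ Dist k ∨ line C t ∈ Read k)))
    {k : ℕ} (hk : j ≤ k) (hpriv : ∀ c c' : PBond P (k + 1), c' ≠ c → centralBond c' ∉ R k c)
    (hpriv' : ∀ c c' : PBond P (k + 2), c' ≠ c → centralBond c' ∉ R (k + 1) c)
    {C : PBond P (k + 2)} (hC : C ∈ Dist (k + 2)) (hCs : C ∉ s (k + 1)) :
    centralBond C ∈ s k ∨ centralBond (centralBond C) ∈ Dist k := by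
  have h1 : centralBond C ∈ Dist (k + 1) := centralBond_mem_dist_of_ghost s R Read Dist hRead hDsucc (Nat.le_succ_of_le hk) hpriv' hC hCs
  by_cases hs : centralBond C ∈ s k
  · exact Or.inl hs
  · exact Or.inr (centralBond_mem_dist_of_ghost s R Read Dist hRead hDsucc hk hpriv h1 hs)

/-- **(PRIV) DISCHARGED FOR THE (0.4) GUARD, membership form**: no bond traversed by a loop word of `c` is the crossing bond of another segment `c′ ≠ c`
(lit ✓`eq_of_mem_walk_loopWord_of_eq_centralBond`) — so any read-set function `R k c` contained in the loop-word bonds of `c` satisfies (PRIV).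
[cite: Balaban1987RG1, (0.4) p.253] -/
theorem centralBond_not_read_by_loopWord {k : ℕ} (hk : k + 1 ≤ P.m + P.K) (c c' : PBond P (k + 1)) (hc : c' ≠ c)
    (Rc : Finset (PBond P k))
    (hRc : ∀ b ∈ Rc, ∃ i : Idx P, ∃ st ∈ walk (emb c.src) (loopWord P.L c.dir (off i.1) i.2.1 i.2.2), st.bond = b) :
    centralBond c' ∉ Rc := by
  intro h
  obtain ⟨i, st, hst, hb⟩ := hRc _ h
  exact hc (eq_of_mem_walk_loopWord_of_eq_centralBond hk c c' i hst hb)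

end Recursion

/-! ## §3 The exit chain: leaving `Dist` yields a private chain down to the bottom level -/
section ExitChain

variable {j : ℕ} (s : (k : ℕ) → Finset (PBond P (k + 1))) (Read : (k : ℕ) → Finset (PBond P k)) (Dist : (k : ℕ) → Finset (PBond P k))

/-- ★★ **THE EXIT CHAIN OF LEMMA (M)**: if a level-`(n+1)` bond `b` is NOT distorted (`j ≤ n`), there is a chain of bonds `c k ∈ PBond P k` with `c (n+1) = b` and, for every
`j ≤ k ≤ n`: `c k` is a bond of the segment of `c (k+1)`, `c k ∉ Dist k`, `c k ∉ Read k`, and `c (k+1)` is not fired.  (Walking down from `b`: not distorted ⇒ not fired and some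
segment bond is neither distorted nor read; iterate.)  In (M)'s proof `b = t_{m+1}` is the first tower bond outside `Dist`, and `U(c j)` is the private Haar slot: no guard ∕ EML map of the
history reads any `c k`, each `c (k+1)` is the axial product of a segment containing `c k`, and `c j` lies on no other segment (§1). [cite: Balaban1987RG1, (0.4) p.253] -/
theorem exists_exit_chain
    (hDsucc : ∀ k, j ≤ k → ∀ C : PBond P (k + 1), C ∈ Dist (k + 1) ↔ (C ∈ s k ∨ ∀ t, t < P.L → (line C t ∈ Dist k ∨ line C t ∈ Read k)))
    {n : ℕ} (hn : j ≤ n) (b : PBond P (n + 1)) (hb : b ∉ Dist (n + 1)) :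
    ∃ c : (k : ℕ) → PBond P k, c (n + 1) = b ∧
      ∀ k, j ≤ k → k ≤ n → (∃ t, t < P.L ∧ c k = line (c (k + 1)) t) ∧ c k ∉ Dist k ∧ c k ∉ Read k ∧ c (k + 1) ∉ s k := by
  revert b
  induction n, hn using Nat.le_induction with
  | base =>
    intro b hb
    obtain ⟨hs, t, ht, hD, hR⟩ := exists_line_not_mem_of_not_mem_dist s Read Dist hDsucc le_rfl hb
    -- a default bond at every level makes the chain a total function of the level (lit `HiggsFluctMeasurePos.nonempty_pBond` is the same remark)
    have c₀ : (k : ℕ) → PBond P k := fun _ => ⟨fun _ => 0, ⟨0, P.hd⟩⟩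
    refine ⟨update (update c₀ (j + 1) b) j (line b t), ?_, ?_⟩
    · rw [update_of_ne (Nat.succ_ne_self j), update_self]
    · intro k hk1 hk2
      have hkj : k = j := le_antisymm hk2 hk1
      subst hkj
      rw [update_self, update_of_ne (Nat.succ_ne_self k), update_self]
      exact ⟨⟨t, ht, rfl⟩, hD, hR, hs⟩
  | succ n hmn ih =>
    intro b hb
    obtain ⟨hs, t, ht, hD, hR⟩ := exists_line_not_mem_of_not_mem_dist s Read Dist hDsucc (Nat.le_succ_of_le hmn) hb
    obtain ⟨c, hcb, hc⟩ := ih (line b t) hD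
    refine ⟨update c (n + 1 + 1) b, by rw [update_self], ?_⟩
    intro k hk1 hk2
    rcases Nat.lt_or_ge k (n + 1) with hlt | hge
    · obtain ⟨h1, h2, h3, h4⟩ := hc k hk1 (Nat.lt_succ_iff.1 hlt)
      rw [update_of_ne (by omega), update_of_ne (by omega)]
      exact ⟨h1, h2, h3, h4⟩
    · have hk : k = n + 1 := le_antisymm hk2 hge
      subst hk
      rw [update_of_ne (Nat.succ_ne_self (n + 1)).symm, update_self, hcb]
      exact ⟨⟨t, ht, rfl⟩, hD, hR, hs⟩

/-- The bottom bond of an exit chain from level `j+1`: not fired, and a segment bond at level `j` that no fired guard reads (the case `n = j`, spelled out). [folklore] -/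
theorem exists_unread_line_of_not_mem_dist_succ_bot
    (hDsucc : ∀ k, j ≤ k → ∀ C : PBond P (k + 1), C ∈ Dist (k + 1) ↔ (C ∈ s k ∨ ∀ t, t < P.L → (line C t ∈ Dist k ∨ line C t ∈ Read k)))
    (b : PBond P (j + 1)) (hb : b ∉ Dist (j + 1)) : b ∉ s j ∧ ∃ t, t < P.L ∧ line b t ∉ Read j := by
  obtain ⟨hs, t, ht, -, hR⟩ := exists_line_not_mem_of_not_mem_dist s Read Dist hDsucc le_rfl hb
  exact ⟨hs, t, ht, hR⟩

end ExitChain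

/-! ## §4 The ghost census -/
section Census

variable {k : ℕ}

/-- ★ **ONE LEVEL OF THE CENSUS**: if every ghost `C ∈ Gh` has all `L` bonds of its segment in `D ∪ Rd`, then `L·#Gh ≤ #D + #(Rd ∩ segments of Gh)` (the `L·#Gh` segment bonds are
pairwise distinct, §1). [cite: Balaban1984PropagatorsI, (1.7) p.18] -/
theorem line_mul_card_ghosts_le [DecidableEq (PBond P k)] (hk : k + 1 ≤ P.m + P.K) (Gh : Finset (PBond P (k + 1))) (D Rd : Finset (PBond P k))
    (hGh : ∀ C ∈ Gh, ∀ t, t < P.L → (line C t ∈ D ∨ line C t ∈ Rd)) :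
    P.L * Gh.card ≤ D.card + (Rd.filter (fun b => ∃ C ∈ Gh, ∃ t, t < P.L ∧ b = line C t)).card := by
  rw [← card_image_line_product hk Gh]
  refine (Finset.card_le_card ?_).trans (Finset.card_union_le _ _)
  intro b hb
  simp only [Finset.mem_image, Finset.mem_product, Finset.mem_range, Prod.exists] at hb
  obtain ⟨C, t, ⟨hC, ht⟩, rfl⟩ := hb
  rcases hGh C hC t ht with h | h
  · exact Finset.mem_union_left _ h
  · exact Finset.mem_union_right _ (Finset.mem_filter.2 ⟨h, C, hC, t, ht, rfl⟩)

/-- ★ **THE READER TERM** under (SIDE): if `Rd ⊆ ⋃_{c ∈ S} R c`, no ghost is fired (`Gh ∩ S = ∅`) and every read set has at most `r₁` bonds on OTHER segments, then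
`#(Rd ∩ segments of Gh) ≤ r₁·#S`. [cite: Balaban1987RG1, (0.4) p.253] -/
theorem card_read_on_ghost_lines_le [DecidableEq (PBond P k)] (Gh S : Finset (PBond P (k + 1))) (R : PBond P (k + 1) → Finset (PBond P k))
    (Rd : Finset (PBond P k)) (hRd : ∀ b ∈ Rd, ∃ c ∈ S, b ∈ R c) (hdisj : ∀ C ∈ Gh, C ∉ S) (r₁ : ℕ)
    (hside : ∀ c ∈ S, ∀ T ⊆ R c, (∀ b ∈ T, ∃ C : PBond P (k + 1), C ≠ c ∧ ∃ t, t < P.L ∧ b = line C t) → T.card ≤ r₁) :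
    (Rd.filter (fun b => ∃ C ∈ Gh, ∃ t, t < P.L ∧ b = line C t)).card ≤ r₁ * S.card := by
  have hsub : Rd.filter (fun b => ∃ C ∈ Gh, ∃ t, t < P.L ∧ b = line C t) ⊆
      S.biUnion (fun c => (R c).filter (fun b => ∃ C ∈ Gh, ∃ t, t < P.L ∧ b = line C t)) := by
    intro b hb
    obtain ⟨hbR, hC⟩ := Finset.mem_filter.1 hb
    obtain ⟨c, hc, hbc⟩ := hRd _ hbR
    exact Finset.mem_biUnion.2 ⟨c, hc, Finset.mem_filter.2 ⟨hbc, hC⟩⟩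
  refine (Finset.card_le_card hsub).trans (Finset.card_biUnion_le.trans ?_)
  calc ∑ c ∈ S, ((R c).filter (fun b => ∃ C ∈ Gh, ∃ t, t < P.L ∧ b = line C t)).card
      ≤ ∑ _c ∈ S, r₁ := Finset.sum_le_sum fun c hc =>
        hside c hc _ (Finset.filter_subset _ _) fun b hb => by
          obtain ⟨-, C, hCG, t, ht, hbt⟩ := Finset.mem_filter.1 hb
          exact ⟨C, fun h => hdisj C hCG (h ▸ hc), t, ht, hbt⟩
    _ = r₁ * S.card := by rw [Finset.sum_const, smul_eq_mul, Nat.mul_comm]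

/-- ★ **ONE LEVEL, ASSEMBLED**: ghosts `Gh ⊆ Dist′ ∖ S` with all segment bonds in `D ∪ Rd`, `Rd ⊆ ⋃_{c∈S} R c`, (SIDE) ⇒ `L·#Gh ≤ #D + r₁·#S`. [folklore] -/
theorem line_mul_card_ghosts_le_of_side [DecidableEq (PBond P k)] (hk : k + 1 ≤ P.m + P.K) (Gh S : Finset (PBond P (k + 1)))
    (R : PBond P (k + 1) → Finset (PBond P k)) (D Rd : Finset (PBond P k))
    (hGh : ∀ C ∈ Gh, ∀ t, t < P.L → (line C t ∈ D ∨ line C t ∈ Rd)) (hRd : ∀ b ∈ Rd, ∃ c ∈ S, b ∈ R c) (hdisj : ∀ C ∈ Gh, C ∉ S) (r₁ : ℕ)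
    (hside : ∀ c ∈ S, ∀ T ⊆ R c, (∀ b ∈ T, ∃ C : PBond P (k + 1), C ≠ c ∧ ∃ t, t < P.L ∧ b = line C t) → T.card ≤ r₁) :
    P.L * Gh.card ≤ D.card + r₁ * S.card :=
  (line_mul_card_ghosts_le hk Gh D Rd hGh).trans (Nat.add_le_add_left (card_read_on_ghost_lines_le Gh S R Rd hRd hdisj r₁ hside) _)

/-- ★ **THE CENSUS TELESCOPED (pure arithmetic)**: rows `L·g k ≤ D k + r₁·f k` (one level) and `D (k+1) ≤ f k + g k` (distorted = fired ∪ ghosts) from `D j = 0` give, for every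
`N ≥ j`, `L·Σ_{[j,N)} g + D N ≤ Σ_{[j,N)} g + (1 + r₁)·Σ_{[j,N)} f`. [folklore] -/
theorem census_of_rows {j : ℕ} (L r₁ : ℕ) (g f D : ℕ → ℕ) (hDj : D j = 0) (hrow : ∀ k, j ≤ k → L * g k ≤ D k + r₁ * f k)
    (hD : ∀ k, j ≤ k → D (k + 1) ≤ f k + g k) {N : ℕ} (hN : j ≤ N) :
    L * (∑ k ∈ Finset.Ico j N, g k) + D N ≤ (∑ k ∈ Finset.Ico j N, g k) + (1 + r₁) * ∑ k ∈ Finset.Ico j N, f k := by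
  induction N, hN using Nat.le_induction with
  | base => simp [hDj]
  | succ N hN ih =>
    rw [Finset.sum_Ico_succ_top hN, Finset.sum_Ico_succ_top hN, Nat.mul_add, Nat.mul_add]
    have h1 := hrow N hN
    have h2 := hD N hN
    nlinarith [h1, h2, ih]

/-- In the form `(L − 1)·#ghosts ≤ (1 + r₁)·#fired`. [folklore] -/
theorem census_of_rows' {j : ℕ} (L r₁ : ℕ) (g f D : ℕ → ℕ) (hDj : D j = 0) (hrow : ∀ k, j ≤ k → L * g k ≤ D k + r₁ * f k)
    (hD : ∀ k, j ≤ k → D (k + 1) ≤ f k + g k) {N : ℕ} (hN : j ≤ N) :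
    (L - 1) * (∑ k ∈ Finset.Ico j N, g k) ≤ (1 + r₁) * ∑ k ∈ Finset.Ico j N, f k := by
  have h := census_of_rows L r₁ g f D hDj hrow hD hN
  rcases Nat.eq_zero_or_pos L with hL | hL
  · simp [hL]
  · have : (L - 1) * (∑ k ∈ Finset.Ico j N, g k) = L * (∑ k ∈ Finset.Ico j N, g k) - ∑ k ∈ Finset.Ico j N, g k := by
      rw [Nat.sub_mul, Nat.one_mul]
    omega

variable {j : ℕ} (s : (k : ℕ) → Finset (PBond P (k + 1))) (R : (k : ℕ) → PBond P (k + 1) → Finset (PBond P k))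
  (Read : (k : ℕ) → Finset (PBond P k)) (Dist : (k : ℕ) → Finset (PBond P k))

/-- ★★ **THE GHOST CENSUS** (FINDING #51 (2), with the constant read off the read sets): for the distorted-set recursion of ANY constrained set with read sets obeying (SIDE)
with constant `r₁`, and every `N ≥ j` inside the standing range,
`L·G + #Dist N ≤ G + (1 + r₁)·F`, `G := Σ_{k∈[j,N)} #(Dist (k+1) ∖ s k)` (all ghosts below level `N`), `F := Σ_{k∈[j,N)} #s k` (all fired sites below `N`) — so
`#ghosts ≤ (1 + r₁)∕(L − 1)·#fired`, uniformly in `N` and `j`.  (Each ghost has `L` distinct segment bonds in `Dist ∪ Read` one level down; `Dist` there is fired ∪ ghosts; a fired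
guard reads at most `r₁` bonds of other segments.) [cite: Balaban1987RG1, (0.3)–(0.4) pp.252–253] -/
theorem ghost_census [∀ k, DecidableEq (PBond P k)] (hRead : ∀ k (b : PBond P k), b ∈ Read k ↔ ∃ c ∈ s k, b ∈ R k c) (hDj : Dist j = ∅)
    (hDsucc : ∀ k, j ≤ k → ∀ C : PBond P (k + 1), C ∈ Dist (k + 1) ↔ (C ∈ s k ∨ ∀ t, t < P.L → (line C t ∈ Dist k ∨ line C t ∈ Read k)))
    (r₁ : ℕ) (hside : ∀ k, j ≤ k → ∀ c ∈ s k, ∀ T ⊆ R k c, (∀ b ∈ T, ∃ C : PBond P (k + 1), C ≠ c ∧ ∃ t, t < P.L ∧ b = line C t) → T.card ≤ r₁)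
    {N : ℕ} (hN : j ≤ N) (hNK : N ≤ P.m + P.K) :
    P.L * (∑ k ∈ Finset.Ico j N, (Dist (k + 1) \ s k).card) + (Dist N).card ≤
      (∑ k ∈ Finset.Ico j N, (Dist (k + 1) \ s k).card) + (1 + r₁) * ∑ k ∈ Finset.Ico j N, (s k).card := by
  -- truncate the rows above `N` so that the standing range is available where the one-level bound is used
  let g : ℕ → ℕ := fun k => if k < N then (Dist (k + 1) \ s k).card else 0
  let f : ℕ → ℕ := fun k => (s k).card
  let D : ℕ → ℕ := fun k => if k ≤ N then (Dist k).card else 0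
  have hrow : ∀ k, j ≤ k → P.L * g k ≤ D k + r₁ * f k := by
    intro k hk
    by_cases hkN : k < N
    · have hk1 : k + 1 ≤ P.m + P.K := by omega
      simp only [g, f, D, if_pos hkN, if_pos hkN.le]
      refine line_mul_card_ghosts_le_of_side hk1 (Dist (k + 1) \ s k) (s k) (R k) (Dist k) (Read k) ?_ ?_ ?_ r₁ (hside k hk)
      · intro C hC t ht
        obtain ⟨hCD, hCs⟩ := Finset.mem_sdiff.1 hC
        exact line_mem_of_ghost s Read Dist hDsucc hk hCD hCs ht
      · intro b hb
        exact (hRead k b).1 hb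
      · intro C hC
        exact (Finset.mem_sdiff.1 hC).2
    · simp only [g, if_neg hkN, Nat.mul_zero]
      exact Nat.zero_le _
  have hD : ∀ k, j ≤ k → D (k + 1) ≤ f k + g k := by
    intro k hk
    by_cases hkN : k < N
    · simp only [g, f, D, if_pos hkN, if_pos (Nat.succ_le_of_lt hkN)]
      calc (Dist (k + 1)).card ≤ (Dist (k + 1) \ s k).card + (s k).card := Finset.card_le_card_sdiff_add_card
        _ = (s k).card + (Dist (k + 1) \ s k).card := Nat.add_comm _ _
    · simp only [D, if_neg (show ¬ (k + 1 ≤ N) by omega)]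
      exact Nat.zero_le _
  have hDj' : D j = 0 := by simp only [D, if_pos hN, hDj, Finset.card_empty]
  have h := census_of_rows P.L r₁ g f D hDj' hrow hD hN
  have hg : ∑ k ∈ Finset.Ico j N, g k = ∑ k ∈ Finset.Ico j N, (Dist (k + 1) \ s k).card :=
    Finset.sum_congr rfl fun k hk => by simp only [g, if_pos (Finset.mem_Ico.1 hk).2]
  have hDN : D N = (Dist N).card := by simp only [D, if_pos le_rfl]
  rw [hg, hDN] at h
  exact h

/-- ★★ **THE GHOST CENSUS, RATIO FORM**: `(L − 1)·#ghosts ≤ (1 + r₁)·#fired` below every level `N` of the standing range. [cite: Balaban1987RG1, (0.3)–(0.4) pp.252–253] -/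
theorem ghost_census' [∀ k, DecidableEq (PBond P k)] (hRead : ∀ k (b : PBond P k), b ∈ Read k ↔ ∃ c ∈ s k, b ∈ R k c) (hDj : Dist j = ∅)
    (hDsucc : ∀ k, j ≤ k → ∀ C : PBond P (k + 1), C ∈ Dist (k + 1) ↔ (C ∈ s k ∨ ∀ t, t < P.L → (line C t ∈ Dist k ∨ line C t ∈ Read k)))
    (r₁ : ℕ) (hside : ∀ k, j ≤ k → ∀ c ∈ s k, ∀ T ⊆ R k c, (∀ b ∈ T, ∃ C : PBond P (k + 1), C ≠ c ∧ ∃ t, t < P.L ∧ b = line C t) → T.card ≤ r₁)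
    {N : ℕ} (hN : j ≤ N) (hNK : N ≤ P.m + P.K) :
    (P.L - 1) * (∑ k ∈ Finset.Ico j N, (Dist (k + 1) \ s k).card) ≤ (1 + r₁) * ∑ k ∈ Finset.Ico j N, (s k).card := by
  have h := ghost_census s R Read Dist hRead hDj hDsucc r₁ hside hN hNK
  have hL := P.L_pos
  have : (P.L - 1) * (∑ k ∈ Finset.Ico j N, (Dist (k + 1) \ s k).card) =
      P.L * (∑ k ∈ Finset.Ico j N, (Dist (k + 1) \ s k).card) - ∑ k ∈ Finset.Ico j N, (Dist (k + 1) \ s k).card := by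
    rw [Nat.sub_mul, Nat.one_mul]
  omega

end Census

end Summit.QuantumFields.YangMills.Theorems.UV3BranchExpansionDistortedSet
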